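import Literature.NumberTheory.Automorphic.GL2CESHModel
import Literature.NumberTheory.Automorphic.GL2CArchOps
import Literature.NumberTheory.Automorphic.GL2CEquivariantPrimitive
import HarnessLib

/-!
# Algebra for the Eichler–Shimura–Harder family: intertwiners of six-operator families,
# entrywise maps of the model, the bases `x_i ∈ 𝔭₀`, `y_α ∈ 𝔰𝔲(2)` as matrices

Pure algebra (no automorphic forms, no analysis) used to read the model cochain
`GL2CESH.eshCochain` (values in `GL2CESH.model C d`, arrays of vectors) as a function:

* `GL2CKType.Ops.Intertwines g O O'` — a linear map intertwining two six-operator families; it then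
  intertwines the derived operators `P₀, P₊, P₋, E_k, F_k, H_k`, `pVec`, `kVec`
  (`Intertwines.pVec`, `Intertwines.kVec`);
* `GL2CESH.mapModel d f` — a linear map `f : C → C'` applied entrywise to the model, which
  intertwines the coefficient families `coeff d` on `model C d` and `model C' d`
  (`intertwines_mapModel_coeff`) and reads the automorphic family entrywise (`mapModel_aut_LE`, …);
* for `O = opsOf (ofRho ρ)` (a real Lie algebra representation `ρ` of `𝔤𝔩₂(ℂ)`):
  **`pVec i = ρ(x_i)`, `kVec α = ρ(y_α)`** with the matrices `Xmat = (H, E+F, i(E−F))`,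
  `Ymat = (iH, E−F, i(E+F))` (`pVec_opsOf`, `kVec_opsOf`);
* the matrices: `Xmat i` is traceless Hermitian, `Ymat α` skew-Hermitian, every traceless Hermitian
  `X` is `∑ xcoord X i • Xmat i` (`sum_xcoord_smul_Xmat`), every skew-Hermitian `Z` is
  `zcoord₀ Z • i·1 + ∑ zcoord Z α • Ymat α`, and **`[y_α, x_i] = ∑_j aTab α i j x_j`**
  (`lie_Ymat_Xmat`) — the structure constants of `GL2CESHCochainAlgebra.aTab`.
[cite: Knapp2002, §VI.1] [cite: BorelWallach2000, II §2.1]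

Definitions with bodies and theorems; no named fact.
-/

noncomputable section

-- Mathlib idiom (Mathlib/Algebra/Lie/OfAssociative.lean), as in `GL2CArchOps`.
attribute [local instance 100] LieRing.ofAssociativeRing

open scoped Matrix ComplexConjugate BigOperators
open Complex Finset Matrix

namespace Literature.NumberTheory.Automorphic

/-! ### Intertwiners of six-operator families -/

namespace GL2CKType

namespace Ops

variable {M M' : Type*} [AddCommGroup M] [Module ℂ M] [AddCommGroup M'] [Module ℂ M']

/-- `g` intertwines the six operators of `O` and `O'`. [folklore] -/
structure Intertwines (g : M →ₗ[ℂ] M') (O : Ops M) (O' : Ops M') : Prop where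
  le : ∀ u, g (O.LE u) = O'.LE (g u)
  lf : ∀ u, g (O.LF u) = O'.LF (g u)
  lh : ∀ u, g (O.LH u) = O'.LH (g u)
  re : ∀ u, g (O.RE u) = O'.RE (g u)
  rf : ∀ u, g (O.RF u) = O'.RF (g u)
  rh : ∀ u, g (O.RH u) = O'.RH (g u)

namespace Intertwines

variable {g : M →ₗ[ℂ] M'} {O : Ops M} {O' : Ops M'} (h : Intertwines g O O')
include h

/-- `g` intertwines `P₀`. [folklore] -/
theorem P0 (u : M) : g (O.P0 u) = O'.P0 (g u) := by rw [P0_apply, P0_apply, map_add, h.lh, h.rh]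
/-- `g` intertwines `P₊`. [folklore] -/
theorem Pp (u : M) : g (O.Pp u) = O'.Pp (g u) := by rw [Pp_apply, Pp_apply, map_add, h.le, h.rf]
/-- `g` intertwines `P₋`. [folklore] -/
theorem Pm (u : M) : g (O.Pm u) = O'.Pm (g u) := by rw [Pm_apply, Pm_apply, map_add, h.lf, h.re]
/-- `g` intertwines `E_k`. [folklore] -/
theorem Ek (u : M) : g (O.Ek u) = O'.Ek (g u) := by rw [Ek_apply, Ek_apply, map_sub, h.le, h.rf]
/-- `g` intertwines `F_k`. [folklore] -/
theorem Fk (u : M) : g (O.Fk u) = O'.Fk (g u) := by rw [Fk_apply, Fk_apply, map_sub, h.lf, h.re]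
/-- `g` intertwines `H_k`. [folklore] -/
theorem Hk (u : M) : g (O.Hk u) = O'.Hk (g u) := by rw [Hk_apply, Hk_apply, map_sub, h.lh, h.rh]

/-- `g` intertwines the `𝔭₀`-operators `pVec`. [folklore] -/
theorem pVec (i : Fin 3) (u : M) : g (O.pVec i u) = O'.pVec i (g u) := by
  fin_cases i
  · exact h.P0 u
  · change g (O.pVec 1 u) = O'.pVec 1 (g u)
    rw [pVec_one, pVec_one, map_add, h.Pp, h.Pm]
  · change g (O.pVec 2 u) = O'.pVec 2 (g u)
    rw [pVec_two, pVec_two, map_smul, map_sub, h.Pp, h.Pm]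

/-- `g` intertwines the `𝔰𝔲(2)`-operators `kVec`. [folklore] -/
theorem kVec (α : Fin 3) (u : M) : g (O.kVec α u) = O'.kVec α (g u) := by
  fin_cases α
  · change g (O.kVec 0 u) = O'.kVec 0 (g u)
    rw [kVec_zero, kVec_zero, map_smul, h.Hk]
  · change g (O.kVec 1 u) = O'.kVec 1 (g u)
    rw [kVec_one, kVec_one, map_sub, h.Ek, h.Fk]
  · change g (O.kVec 2 u) = O'.kVec 2 (g u)
    rw [kVec_two, kVec_two, map_smul, map_add, h.Ek, h.Fk]

end Intertwines

/-- Packaging six pointwise identities of a linear equivalence. [folklore] -/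
theorem intertwines_of_equiv {e : M ≃ₗ[ℂ] M'} {O : Ops M} {O' : Ops M'}
    (h : (∀ u, e (O.LE u) = O'.LE (e u)) ∧ (∀ u, e (O.LF u) = O'.LF (e u)) ∧ (∀ u, e (O.LH u) = O'.LH (e u)) ∧
      (∀ u, e (O.RE u) = O'.RE (e u)) ∧ (∀ u, e (O.RF u) = O'.RF (e u)) ∧ (∀ u, e (O.RH u) = O'.RH (e u))) :
    Intertwines (e : M →ₗ[ℂ] M') O O' :=
  ⟨h.1, h.2.1, h.2.2.1, h.2.2.2.1, h.2.2.2.2.1, h.2.2.2.2.2⟩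

end Ops

/-! ### `pVec`, `kVec` through `ρ` -/

section Rho

open GLnComplexCasimir GL2ComplexCasimir

variable {C : Type*} [AddCommGroup C] [Module ℂ C] (ρ : Matrix (Fin 2) (Fin 2) ℂ →ₗ⁅ℝ⁆ Module.End ℂ C)

/-- The basis `x = (H, E+F, i(E−F))` of `𝔭₀` as matrices. [cite: Knapp2002, §VI.1] -/
def Xmat : Fin 3 → Matrix (Fin 2) (Fin 2) ℂ := ![mH, mE + mF, I • (mE - mF)]

/-- The basis `y = (iH, E−F, i(E+F))` of `𝔰𝔲(2)` as matrices. [cite: Knapp2002, §VI.1] -/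
def Ymat : Fin 3 → Matrix (Fin 2) (Fin 2) ℂ := ![I • mH, mE - mF, I • (mE + mF)]

/-- Unfolding. [folklore] -/
@[simp] theorem Xmat_zero : Xmat 0 = mH := rfl
/-- Unfolding. [folklore] -/
@[simp] theorem Xmat_one : Xmat 1 = mE + mF := rfl
/-- Unfolding. [folklore] -/
@[simp] theorem Xmat_two : Xmat 2 = I • (mE - mF) := rfl
/-- Unfolding. [folklore] -/
@[simp] theorem Ymat_zero : Ymat 0 = I • mH := rfl
/-- Unfolding. [folklore] -/
@[simp] theorem Ymat_one : Ymat 1 = mE - mF := rfl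
/-- Unfolding. [folklore] -/
@[simp] theorem Ymat_two : Ymat 2 = I • (mE + mF) := rfl

/-- `ρ` is real-linear: `ρ(−Y) = −ρ(Y)`, as needed below. [folklore] -/
theorem rho_sub (X Y : Matrix (Fin 2) (Fin 2) ℂ) (v : C) : ρ (X - Y) v = ρ X v - ρ Y v := by
  rw [map_sub, LinearMap.sub_apply]

/-- **`pVec i = ρ(x_i)`** for `O = opsOf (ofRho ρ)`. [cite: Knapp2002, §VI.1] -/
theorem pVec_opsOf (i : Fin 3) (v : C) : (opsOf (ofRho ρ)).pVec i v = ρ (Xmat i) v := by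
  fin_cases i
  · exact P0_eq_rho ρ v
  · change (opsOf (ofRho ρ)).pVec 1 v = ρ (Xmat 1) v
    rw [Ops.pVec_one, Pp_eq, Pm_eq, Xmat_one]
    module
  · change (opsOf (ofRho ρ)).pVec 2 v = ρ (Xmat 2) v
    rw [Ops.pVec_two, Pp_eq, Pm_eq, Xmat_two]
    simp only [smul_sub, smul_add, smul_smul]
    rw [show I * ((2 : ℂ)⁻¹ * I) = -(2 : ℂ)⁻¹ by rw [mul_left_comm, I_mul_I]; ring]
    module

/-- **`kVec α = ρ(y_α)`** for `O = opsOf (ofRho ρ)`. [cite: Knapp2002, §VI.1] -/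
theorem kVec_opsOf (α : Fin 3) (v : C) : (opsOf (ofRho ρ)).kVec α v = ρ (Ymat α) v := by
  fin_cases α
  · change (opsOf (ofRho ρ)).kVec 0 v = ρ (Ymat 0) v
    rw [Ops.kVec_zero, Hk_eq, Ymat_zero, smul_neg, smul_smul, I_mul_I, neg_smul, one_smul, neg_neg]
  · change (opsOf (ofRho ρ)).kVec 1 v = ρ (Ymat 1) v
    rw [Ops.kVec_one, Ek_eq, Fk_eq, Ymat_one, show mF - mE = -(mE - mF) by abel, map_neg, LinearMap.neg_apply]
    module
  · change (opsOf (ofRho ρ)).kVec 2 v = ρ (Ymat 2) v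
    rw [Ops.kVec_two, Ek_eq, Fk_eq, Ymat_two, show mF - mE = -(mE - mF) by abel, map_neg, LinearMap.neg_apply]
    simp only [smul_sub, smul_add, smul_neg, smul_smul]
    rw [show I * ((2 : ℂ)⁻¹ * I) = -(2 : ℂ)⁻¹ by rw [mul_left_comm, I_mul_I]; ring]
    module

end Rho

end GL2CKType

/-! ### The matrices -/

namespace GL2CESHMat

open GL2CKType GL2C

/-- `x_i ∈ 𝔭₀`: traceless Hermitian. [cite: Knapp2002, §VI.1] -/
theorem isHT_Xmat (i : Fin 3) : IsHT (Xmat i) := by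
  fin_cases i
  · show IsHT (Xmat 0)
    refine ⟨?_, trace_mH⟩
    rw [Xmat_zero, mH_eq]; ext i j; fin_cases i <;> fin_cases j <;> simp [conjTranspose]
  · show IsHT (Xmat 1)
    refine ⟨?_, by rw [Xmat_one, trace_add, trace_mE, trace_mF, add_zero]⟩
    rw [Xmat_one, mE_eq, mF_eq]; ext i j; fin_cases i <;> fin_cases j <;> simp [conjTranspose]
  · show IsHT (Xmat 2)
    refine ⟨?_, by rw [Xmat_two, trace_smul, trace_sub, trace_mE, trace_mF, sub_zero, smul_zero]⟩
    rw [Xmat_two, mE_eq, mF_eq]; ext i j; fin_cases i <;> fin_cases j <;> simp [conjTranspose, conj_I]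

/-- `y_α ∈ 𝔲(2)`: skew-Hermitian. [cite: Knapp2002, §VI.1] -/
theorem conjTranspose_Ymat (α : Fin 3) : (Ymat α)ᴴ = -Ymat α := by
  fin_cases α
  · show (Ymat 0)ᴴ = -Ymat 0; exact conjTranspose_I_smul_mH
  · show (Ymat 1)ᴴ = -Ymat 1; exact conjTranspose_mE_sub_mF
  · show (Ymat 2)ᴴ = -Ymat 2; exact conjTranspose_I_smul_mE_add_mF

/-- The real coordinates of a traceless Hermitian `X = [[a, z], [z̄, −a]]` in the basis `x`:
`(a, re z, im z)`. [folklore] -/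
def xcoord (X : Mat) : Fin 3 → ℝ := ![(X 0 0).re, (X 0 1).re, (X 0 1).im]

/-- `xcoord` is real-linear. [folklore] -/
def xcoordLM : Mat →ₗ[ℝ] (Fin 3 → ℝ) where
  toFun := xcoord
  map_add' X Y := by
    funext i; fin_cases i <;> simp [xcoord]
  map_smul' r X := by
    funext i; fin_cases i <;> simp [xcoord]

/-- Unfolding. [folklore] -/
@[simp] theorem xcoordLM_apply (X : Mat) : xcoordLM X = xcoord X := rfl

/-- A traceless Hermitian matrix is `[[a, z], [z̄, −a]]` with `a` real. [folklore] -/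
theorem eq_of_isHT {X : Mat} (hX : IsHT X) :
    X = !![(((X 0 0).re : ℝ) : ℂ), X 0 1; conj (X 0 1), -(((X 0 0).re : ℝ) : ℂ)] := by
  have h10 : X 1 0 = conj (X 0 1) := by
    have := congrFun (congrFun hX.1 1) 0
    rw [conjTranspose_apply, star_def] at this
    exact this.symm
  have h00 : conj (X 0 0) = X 0 0 := by
    have := congrFun (congrFun hX.1 0) 0
    rwa [conjTranspose_apply, star_def] at this
  have h11 : X 1 1 = -X 0 0 := by
    have := hX.2
    rw [trace_fin_two] at this
    linear_combination this
  have h00r : ((X 0 0).re : ℂ) = X 0 0 := conj_eq_iff_re.1 h00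
  ext i j
  fin_cases i <;> fin_cases j
  · simp [h00r]
  · simp
  · simp [h10]
  · simp [h11, h00r]

/-- **Decomposition of `𝔭₀`**: `X = ∑ xcoord X i • x_i` for `X` traceless Hermitian. [cite: Knapp2002, §VI.1] -/
theorem sum_xcoord_smul_Xmat {X : Mat} (hX : IsHT X) : ∑ i, ((xcoord X i : ℝ) : ℂ) • Xmat i = X := by
  conv_rhs => rw [eq_of_isHT hX]
  rw [Fin.sum_univ_three, Xmat_zero, Xmat_one, Xmat_two, mH_eq, mE_eq, mF_eq]
  ext i j
  fin_cases i <;> fin_cases j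
  · simp [xcoord]
  · simp [xcoord]
  · simp [xcoord]
    apply Complex.ext <;> simp
  · simp [xcoord]

/-- The coordinates of a real combination of the `x_i`. [folklore] -/
theorem xcoord_sum_smul_Xmat (c : Fin 3 → ℝ) : xcoord (∑ i, ((c i : ℝ) : ℂ) • Xmat i) = c := by
  funext j
  rw [Fin.sum_univ_three, Xmat_zero, Xmat_one, Xmat_two, mH_eq, mE_eq, mF_eq]
  fin_cases j <;> simp [xcoord]

/-- The real structure constants (`aTab` has entries `0, ±2`). [folklore] -/
def aRe : Fin 3 → Fin 3 → Fin 3 → ℝ :=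
  ![![![0, 0, 0], ![0, 0, 2], ![0, -2, 0]],
    ![![0, -2, 0], ![2, 0, 0], ![0, 0, 0]],
    ![![0, 0, -2], ![0, 0, 0], ![2, 0, 0]]]

/-- `aRe` is `aTab`. [folklore] -/
theorem aRe_eq (α i j : Fin 3) : ((aRe α i j : ℝ) : ℂ) = aTab α i j := by
  fin_cases α <;> fin_cases i <;> fin_cases j <;> simp [aRe, aTab]

/-- **The structure constants: `[y_α, x_i] = ∑_j aTab α i j • x_j`.** [cite: Knapp2002, §VI.1] -/
theorem lie_Ymat_Xmat (α i : Fin 3) : ⁅Ymat α, Xmat i⁆ = ∑ j, aTab α i j • Xmat j := by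
  rw [Fin.sum_univ_three, Ring.lie_def]
  fin_cases α <;> fin_cases i <;>
    simp only [Ymat_zero, Ymat_one, Ymat_two, Xmat_zero, Xmat_one, Xmat_two, aTab, mH_eq, mE_eq, mF_eq,
      Fin.zero_eta, Fin.mk_one, Fin.reduceFinMk, Matrix.cons_val_zero, Matrix.cons_val_one, Matrix.cons_val_two,
      Matrix.head_cons, Matrix.tail_cons] <;>
    ext i j <;> fin_cases i <;> fin_cases j <;> simp <;> ring_nf

/-- Hence for traceless Hermitian `X`: `[y_α, X] = ∑_j (∑_i xcoord X i · aRe α i j) • x_j`. [cite: Knapp2002, §VI.1] -/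
theorem lie_Ymat_of_isHT (α : Fin 3) {X : Mat} (hX : IsHT X) :
    ⁅Ymat α, X⁆ = ∑ j, (((∑ i, xcoord X i * aRe α i j : ℝ) : ℝ) : ℂ) • Xmat j := by
  conv_lhs => rw [← sum_xcoord_smul_Xmat hX]
  have hlin : ⁅Ymat α, ∑ i, ((xcoord X i : ℝ) : ℂ) • Xmat i⁆ = ∑ i, ((xcoord X i : ℝ) : ℂ) • ⁅Ymat α, Xmat i⁆ := by
    rw [Ring.lie_def, Finset.mul_sum, Finset.sum_mul, ← Finset.sum_sub_distrib]
    refine Finset.sum_congr rfl fun i _ => ?_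
    rw [Ring.lie_def, mul_smul_comm, smul_mul_assoc, smul_sub]
  rw [hlin]
  simp_rw [lie_Ymat_Xmat, Finset.smul_sum, smul_smul]
  rw [Finset.sum_comm]
  refine Finset.sum_congr rfl fun j _ => ?_
  rw [← Finset.sum_smul]
  congr 1
  push_cast
  refine Finset.sum_congr rfl fun i _ => ?_
  rw [aRe_eq]

/-- The coordinates of `[y_α, X]`. [folklore] -/
theorem xcoord_lie_Ymat (α : Fin 3) {X : Mat} (hX : IsHT X) (j : Fin 3) :
    xcoord ⁅Ymat α, X⁆ j = ∑ i, xcoord X i * aRe α i j := by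
  rw [lie_Ymat_of_isHT α hX, xcoord_sum_smul_Xmat]

/-- The centre coordinate of a skew-Hermitian `Z = [[ia, w], [−w̄, ib]]`: `(a + b)/2`. [folklore] -/
def zcoord₀ (Z : Mat) : ℝ := ((Z 0 0).im + (Z 1 1).im) / 2

/-- The `𝔰𝔲(2)`-coordinates of a skew-Hermitian `Z`: `((a − b)/2, re w, im w)`. [folklore] -/
def zcoord (Z : Mat) : Fin 3 → ℝ := ![((Z 0 0).im - (Z 1 1).im) / 2, (Z 0 1).re, (Z 0 1).im]

/-- A skew-Hermitian matrix is `[[ia, w], [−w̄, ib]]` with `a, b` real. [folklore] -/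
theorem eq_of_skewHermitian {Z : Mat} (hZ : Zᴴ = -Z) :
    Z = !![(((Z 0 0).im : ℝ) : ℂ) * I, Z 0 1; -conj (Z 0 1), (((Z 1 1).im : ℝ) : ℂ) * I] := by
  have h00 : conj (Z 0 0) = -Z 0 0 := by
    have := congrFun (congrFun hZ 0) 0
    rwa [conjTranspose_apply, star_def, Matrix.neg_apply] at this
  have h11 : conj (Z 1 1) = -Z 1 1 := by
    have := congrFun (congrFun hZ 1) 1
    rwa [conjTranspose_apply, star_def, Matrix.neg_apply] at this
  have h10 : Z 1 0 = -conj (Z 0 1) := by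
    have := congrFun (congrFun hZ 1) 0
    rw [conjTranspose_apply, star_def, Matrix.neg_apply] at this
    rw [this, neg_neg]
  have h00' : Z 0 0 = ((Z 0 0).im : ℂ) * I := by
    have hre : (Z 0 0).re = 0 := by
      have := congrArg re h00; simp at this; linarith
    conv_lhs => rw [← re_add_im (Z 0 0), hre]
    simp
  have h11' : Z 1 1 = ((Z 1 1).im : ℂ) * I := by
    have hre : (Z 1 1).re = 0 := by
      have := congrArg re h11; simp at this; linarith
    conv_lhs => rw [← re_add_im (Z 1 1), hre]
    simp
  ext i j
  fin_cases i <;> fin_cases j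
  · simpa using h00'
  · simp
  · simpa using h10
  · simpa using h11'

/-- **Decomposition of `𝔲(2)`**: `Z = zcoord₀ Z • i·1 + ∑ zcoord Z α • y_α` for `Zᴴ = −Z`. [cite: Knapp2002, §VI.1] -/
theorem zcoord_decomp {Z : Mat} (hZ : Zᴴ = -Z) :
    ((zcoord₀ Z : ℝ) : ℂ) • (I • (1 : Mat)) + ∑ α, ((zcoord Z α : ℝ) : ℂ) • Ymat α = Z := by
  conv_rhs => rw [eq_of_skewHermitian hZ]
  rw [Fin.sum_univ_three, Ymat_zero, Ymat_one, Ymat_two, mH_eq, mE_eq, mF_eq]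
  ext i j
  fin_cases i <;> fin_cases j
  · simp [zcoord₀, zcoord]
    ring
  · simp [zcoord₀, zcoord]
  · simp [zcoord₀, zcoord]
    apply Complex.ext <;> simp
  · simp [zcoord₀, zcoord]
    ring

/-- The centre commutes: `[i·1, X] = 0`. [folklore] -/
theorem lie_I_smul_one (X : Mat) : ⁅I • (1 : Mat), X⁆ = 0 := by
  rw [Ring.lie_def, smul_mul_assoc, one_mul, mul_smul_comm, mul_one, sub_self]

end GL2CESHMat

/-! ### Entrywise maps of the model -/

namespace GL2CESH

open GL2CKType Sl2Coord

variable {C C' : Type*} [AddCommGroup C] [Module ℂ C] [AddCommGroup C'] [Module ℂ C'] (d : ℕ)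

/-- **A linear map applied entrywise to the model.** [folklore] -/
def mapModel (f : C →ₗ[ℂ] C') : model C d →ₗ[ℂ] model C' d where
  toFun u := ⟨fun l m => f ((u : ℕ → ℕ → C) l m), fun l m h => by
    change f ((u : ℕ → ℕ → C) l m) = 0
    rw [u.2 l m h, map_zero]⟩
  map_add' u v := Subtype.ext (funext fun l => funext fun m => by
    change f (((u + v : model C d) : ℕ → ℕ → C) l m) = f ((u : ℕ → ℕ → C) l m) + f ((v : ℕ → ℕ → C) l m)
    rw [Submodule.coe_add, Pi.add_apply, Pi.add_apply, map_add])
  map_smul' c u := Subtype.ext (funext fun l => funext fun m => by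
    change f (((c • u : model C d) : ℕ → ℕ → C) l m) = c • f ((u : ℕ → ℕ → C) l m)
    rw [Submodule.coe_smul, Pi.smul_apply, Pi.smul_apply, map_smul])

/-- Unfolding. [folklore] -/
@[simp] theorem mapModel_apply (f : C →ₗ[ℂ] C') (u : model C d) (l m : ℕ) :
    ((mapModel d f u : model C' d) : ℕ → ℕ → C') l m = f ((u : ℕ → ℕ → C) l m) := rfl

/-- **Entrywise maps intertwine the coefficient families.** [cite: FultonHarrisGTM129, §11.1] -/
theorem intertwines_mapModel_coeff (f : C →ₗ[ℂ] C') :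
    Ops.Intertwines (mapModel d f) (coeff (C := C) d) (coeff (C := C') d) := by
  refine ⟨fun u => ?_, fun u => ?_, fun u => ?_, fun u => ?_, fun u => ?_, fun u => ?_⟩ <;>
    refine Subtype.ext (funext fun l => funext fun m => ?_) <;>
    simp only [mapModel_apply, coeff, Ops.restrict_LE, Ops.restrict_LF, Ops.restrict_LH, Ops.restrict_RE,
      Ops.restrict_RF, Ops.restrict_RH]
  · rcases l with _ | l
    · rw [opsCoeff_LE_apply_zero, opsCoeff_LE_apply_zero, map_zero]
    · rw [opsCoeff_LE_apply_succ, opsCoeff_LE_apply_succ, map_smul, mapModel_apply]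
  · rw [opsCoeff_LF_apply, opsCoeff_LF_apply, map_smul, mapModel_apply]
  · rw [opsCoeff_LH_apply, opsCoeff_LH_apply, map_smul, mapModel_apply]
  · rw [opsCoeff_RE, opsCoeff_RE]
    rcases m with _ | m
    · rw [sE_apply_zero, sE_apply_zero, map_zero]
    · rw [sE_apply_succ, sE_apply_succ, map_smul, mapModel_apply]
  · rw [opsCoeff_RF, opsCoeff_RF, sF_apply, sF_apply, map_smul, mapModel_apply]
  · rw [opsCoeff_RH, opsCoeff_RH, sH_apply, sH_apply, map_smul, mapModel_apply]

section Aut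

variable (O : Ops C) (f : C →ₗ[ℂ] C') (u : model C d) (l m : ℕ)

/-- Entrywise reading of the automorphic family: `L(E)`. [folklore] -/
@[simp] theorem mapModel_aut_LE : ((mapModel d f ((aut O d).LE u) : model C' d) : ℕ → ℕ → C') l m = f (O.LE ((u : ℕ → ℕ → C) l m)) := rfl
/-- Entrywise reading of the automorphic family: `L(F)`. [folklore] -/
@[simp] theorem mapModel_aut_LF : ((mapModel d f ((aut O d).LF u) : model C' d) : ℕ → ℕ → C') l m = f (O.LF ((u : ℕ → ℕ → C) l m)) := rfl
/-- Entrywise reading of the automorphic family: `L(H)`. [folklore] -/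
@[simp] theorem mapModel_aut_LH : ((mapModel d f ((aut O d).LH u) : model C' d) : ℕ → ℕ → C') l m = f (O.LH ((u : ℕ → ℕ → C) l m)) := rfl
/-- Entrywise reading of the automorphic family: `R(E)`. [folklore] -/
@[simp] theorem mapModel_aut_RE : ((mapModel d f ((aut O d).RE u) : model C' d) : ℕ → ℕ → C') l m = f (O.RE ((u : ℕ → ℕ → C) l m)) := rfl
/-- Entrywise reading of the automorphic family: `R(F)`. [folklore] -/
@[simp] theorem mapModel_aut_RF : ((mapModel d f ((aut O d).RF u) : model C' d) : ℕ → ℕ → C') l m = f (O.RF ((u : ℕ → ℕ → C) l m)) := rfl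
/-- Entrywise reading of the automorphic family: `R(H)`. [folklore] -/
@[simp] theorem mapModel_aut_RH : ((mapModel d f ((aut O d).RH u) : model C' d) : ℕ → ℕ → C') l m = f (O.RH ((u : ℕ → ℕ → C) l m)) := rfl

/-- Entrywise reading of `pVec` of the automorphic family. [folklore] -/
theorem mapModel_aut_pVec (i : Fin 3) :
    ((mapModel d f ((aut O d).pVec i u) : model C' d) : ℕ → ℕ → C') l m = f (O.pVec i ((u : ℕ → ℕ → C) l m)) := by
  fin_cases i
  · change ((mapModel d f ((aut O d).pVec 0 u) : model C' d) : ℕ → ℕ → C') l m = f (O.pVec 0 _)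
    rw [Ops.pVec_zero, Ops.pVec_zero, Ops.P0_apply, Ops.P0_apply, map_add, map_add]; rfl
  · change ((mapModel d f ((aut O d).pVec 1 u) : model C' d) : ℕ → ℕ → C') l m = f (O.pVec 1 _)
    rw [Ops.pVec_one, Ops.pVec_one, Ops.Pp_apply, Ops.Pm_apply, Ops.Pp_apply, Ops.Pm_apply]
    simp only [map_add]; rfl
  · change ((mapModel d f ((aut O d).pVec 2 u) : model C' d) : ℕ → ℕ → C') l m = f (O.pVec 2 _)
    rw [Ops.pVec_two, Ops.pVec_two, Ops.Pp_apply, Ops.Pm_apply, Ops.Pp_apply, Ops.Pm_apply]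
    simp only [map_add, map_sub, map_smul]; rfl

/-- Entrywise reading of `kVec` of the automorphic family. [folklore] -/
theorem mapModel_aut_kVec (α : Fin 3) :
    ((mapModel d f ((aut O d).kVec α u) : model C' d) : ℕ → ℕ → C') l m = f (O.kVec α ((u : ℕ → ℕ → C) l m)) := by
  fin_cases α
  · change ((mapModel d f ((aut O d).kVec 0 u) : model C' d) : ℕ → ℕ → C') l m = f (O.kVec 0 _)
    rw [Ops.kVec_zero, Ops.kVec_zero, Ops.Hk_apply, Ops.Hk_apply]
    simp only [map_smul, map_sub]; rfl
  · change ((mapModel d f ((aut O d).kVec 1 u) : model C' d) : ℕ → ℕ → C') l m = f (O.kVec 1 _)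
    rw [Ops.kVec_one, Ops.kVec_one, Ops.Ek_apply, Ops.Fk_apply, Ops.Ek_apply, Ops.Fk_apply]
    simp only [map_sub]; rfl
  · change ((mapModel d f ((aut O d).kVec 2 u) : model C' d) : ℕ → ℕ → C') l m = f (O.kVec 2 _)
    rw [Ops.kVec_two, Ops.kVec_two, Ops.Ek_apply, Ops.Fk_apply, Ops.Ek_apply, Ops.Fk_apply]
    simp only [map_add, map_sub, map_smul]; rfl

end Aut

end GL2CESH

end Literature.NumberTheory.Automorphic

end
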